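import Mathlib
import HarnessLib
import Literature.NumberTheory.Automorphic.StrongArtinCentralCharacter
import Literature.NumberTheory.Automorphic.NewformAdelisationHeckeOperator
import Literature.NumberTheory.Automorphic.HeckeCharacterOfDirichletLevel
import Literature.NumberTheory.Automorphic.NewformAdelisationDescent

/-!
# Crux `CorrespondentFingerprint` (stmt-Langlands-15898), line `Sketch`, stub `stub_descent`:
# auxiliary file 1 — the unit idele of a residue class and the nebentypus of a `K₁(N)`-vector

For the weight-`0` descent of a `K₁(N)`-fixed vector `φ` on `GL₂(𝔸_ℚ)` with central character
`ψ_{χ} = HeckeCharacter.ofDirichlet χ` one needs `K₀(N) = Z(𝒪̂ˣ) · K₁(N)` in the following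
concrete form: for `γ = (a b; c d) ∈ Γ₀(N)` the finite part of `γ⁻¹` is `z · k₁` with `k₁ ∈ K₁(N)`
and `z` the scalar matrix of the idele `z(a)` which is `a` at the primes dividing `N` and `1`
elsewhere; and `ψ_{χ}(z(a)) = χ(a)⁻¹ = χ(d)`.  This file constructs `z(a)`
(`exists_levelUnitIdele`, an existence statement — no definitions), computes its ray class, and
proves the adelic nebentypus identity `φ((γ_∞ g, 1)) = χ(d) φ((g, 1))` for `γ ∈ Γ₀(N)`
(`apply_ofRealGL_gamma0_mul`; registered sub-goal `stub_descent_nebentypus`).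
Theorems only; no `sorry`.
-/

set_option linter.dupNamespace false

noncomputable section

open scoped MatrixGroups Matrix NumberField
open Literature.NumberTheory.Automorphic Literature.NumberTheory.GaloisRepresentations
  IsDedekindDomain NumberField
open Rat.HeightOneSpectrum IsDedekindDomain.HeightOneSpectrum

namespace Summit.Langlands.Langlands.Theorems.CorrespondentFingerprint

section LevelUnit

variable (N : ℕ) [NeZero N]

omit [NeZero N] in
/-- An integer prime to `N` is a unit at every place dividing `N`. [folklore] -/
theorem valuation_intCast_eq_one_of_isCoprime {a : ℤ} (ha : IsCoprime a N) {v : HeightOneSpectrum (𝓞 ℚ)}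
    (hv : v.asIdeal ∣ Ideal.span {(N : 𝓞 ℚ)}) : v.valuation ℚ (a : ℚ) = 1 := by
  refine Rat.valuation_intCast_eq_one v fun hdvd => ?_
  have hpN : (natGenerator v : ℤ) ∣ (N : ℤ) :=
    Int.natCast_dvd_natCast.2 ((Rat.natGenerator_dvd_iff v N).2 hv)
  have h1 : (natGenerator v : ℤ) ∣ 1 := by
    obtain ⟨x, y, hxy⟩ := ha
    rw [← hxy]
    exact dvd_add (dvd_mul_of_dvd_right hdvd x) (dvd_mul_of_dvd_right hpN y)
  exact (prime_natGenerator v).ne_one (by exact_mod_cast Int.eq_one_of_dvd_one (by positivity) h1)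

/-- **The level unit idele `z(a)` of an integer `a` prime to `N`**: there is an idele `z` of `ℚ`
which is `1` at infinity, `a` at the primes dividing `N` and `1` at the other primes (so that all
its finite components are units), together with its finite part `z_f ∈ (𝔸_ℚ^∞)ˣ`; its ray class
mod `N` is the class of `a`. [folklore] -/
theorem exists_levelUnitIdele {a : ℤ} (ha : IsCoprime a N) :
    ∃ (z : ideleGroup ℚ) (zf : (FiniteAdeleRing (𝓞 ℚ) ℚ)ˣ),
      (z : AdeleRing (𝓞 ℚ) ℚ) = ((1 : InfiniteAdeleRing ℚ), (zf : FiniteAdeleRing (𝓞 ℚ) ℚ)) ∧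
      (∀ v : HeightOneSpectrum (𝓞 ℚ), v.asIdeal ∣ Ideal.span {(N : 𝓞 ℚ)} →
        (zf : FiniteAdeleRing (𝓞 ℚ) ℚ) v = algebraMap ℚ (v.adicCompletion ℚ) (a : ℚ)) ∧
      (∀ v : HeightOneSpectrum (𝓞 ℚ), ¬ v.asIdeal ∣ Ideal.span {(N : 𝓞 ℚ)} → (zf : FiniteAdeleRing (𝓞 ℚ) ℚ) v = 1) ∧
      (∀ v : HeightOneSpectrum (𝓞 ℚ), Valued.v ((zf : FiniteAdeleRing (𝓞 ℚ) ℚ) v) = 1) ∧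
      ((Rat.rayClassHom N z : (ZMod N)ˣ) : ZMod N) = (a : ZMod N) := by
  classical
  -- the components
  let f : (v : HeightOneSpectrum (𝓞 ℚ)) → v.adicCompletion ℚ := fun v =>
    if v.asIdeal ∣ Ideal.span {(N : 𝓞 ℚ)} then algebraMap ℚ (v.adicCompletion ℚ) (a : ℚ) else 1
  have hf1 : ∀ v, Valued.v (f v) = 1 := fun v => by
    simp only [f]
    split_ifs with hv
    · rw [Literature.NumberTheory.GaloisRepresentations.valued_algebraMap_adicCompletion]
      exact valuation_intCast_eq_one_of_isCoprime N ha hv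
    · rw [map_one]
  let x : FiniteAdeleRing (𝓞 ℚ) ℚ :=
    ⟨f, Filter.Eventually.of_forall fun v => (mem_adicCompletionIntegers (R := 𝓞 ℚ) ℚ v).2 (hf1 v).le⟩
  have hx : ∀ v, x v = f v := fun v => rfl
  have hxu : IsUnit x := by
    rw [FiniteAdeleRing.isUnit_iff]
    refine ⟨fun v h0 => ?_, Filter.Eventually.of_forall fun v => by rw [hx]; exact hf1 v⟩
    have h := hf1 v
    rw [← hx, h0, map_zero] at h
    exact zero_ne_one h
  set zf : (FiniteAdeleRing (𝓞 ℚ) ℚ)ˣ := hxu.unit with hzf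
  have hzfx : (zf : FiniteAdeleRing (𝓞 ℚ) ℚ) = x := hxu.unit_spec
  set z : ideleGroup ℚ := Units.map (MonoidHom.inr (InfiniteAdeleRing ℚ) (FiniteAdeleRing (𝓞 ℚ) ℚ) :
    FiniteAdeleRing (𝓞 ℚ) ℚ →* AdeleRing (𝓞 ℚ) ℚ) zf with hz
  have hzval : (z : AdeleRing (𝓞 ℚ) ℚ) = ((1 : InfiniteAdeleRing ℚ), (zf : FiniteAdeleRing (𝓞 ℚ) ℚ)) := rfl
  have hzsnd : ∀ v, ((z : AdeleRing (𝓞 ℚ) ℚ)).2 v = f v := fun v => by rw [hzval, hzfx]; rfl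
  have hzunit : ∀ v, Valued.v (((z : AdeleRing (𝓞 ℚ) ℚ)).2 v) = 1 := fun v => by rw [hzsnd]; exact hf1 v
  refine ⟨z, zf, hzval, fun v hv => ?_, fun v hv => ?_, fun v => ?_, ?_⟩
  · rw [hzfx, hx]; exact if_pos hv
  · rw [hzfx, hx]; exact if_neg hv
  · rw [hzfx, hx]; exact hf1 v
  -- the ray class
  have hinf : Rat.infReal z = 1 := by
    rw [Rat.infReal_apply, hzval]
    exact map_one _
  rw [Rat.rayClassHom_eq_redMod N _ (by rw [hinf]; exact one_pos) hzunit]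
  refine (ZMod.equivPi (n := N) (NeZero.ne N)).injective (funext fun q => ?_)
  haveI := Rat.fact_prime_natGenerator (Rat.placeOfFactor N q)
  have hvN : (Rat.placeOfFactor N q).asIdeal ∣ Ideal.span {(N : 𝓞 ℚ)} :=
    (Rat.natGenerator_dvd_iff _ N).1 (Rat.natGenerator_placeOfFactor_dvd N q)
  have hcomp : ((z : AdeleRing (𝓞 ℚ) ℚ)).2 (Rat.placeOfFactor N q) =
      algebraMap ℚ ((Rat.placeOfFactor N q).adicCompletion ℚ) (a : ℚ) := by
    rw [hzsnd]; exact if_pos hvN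
  have hunit : (Rat.padicUnitPart (Rat.placeOfFactor N q) z : ℤ_[natGenerator (Rat.placeOfFactor N q)]) =
      (a : ℤ_[natGenerator (Rat.placeOfFactor N q)]) := by
    refine PadicInt.ext ?_
    rw [Rat.coe_padicUnitPart_of_valued_eq_one _ _ (hzunit _), Rat.padicComp_apply, hcomp,
      Rat.toPadic_algebraMap, Rat.cast_intCast, PadicInt.coe_intCast]
  rw [Rat.equivPi_redMod, Rat.val_localRedFactor, Rat.val_localRed, hunit, map_intCast, map_intCast,
    map_intCast, Pi.intCast_apply]

variable {N}

/-- **`ψ_{χ}(z) = χ(d)`** for an idele `z` of ray class `a mod N` and `a d ≡ 1 (mod N)`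
(`ψ_χ(x) = χ(u(x) mod N)⁻¹`). [folklore] -/
theorem ofDirichlet_eq_of_rayClassHom (χ : DirichletCharacter ℂ N) {z : ideleGroup ℚ} {a d : ℤ}
    (hz : ((Rat.rayClassHom N z : (ZMod N)ˣ) : ZMod N) = (a : ZMod N)) (had : (a : ZMod N) * d = 1) :
    ((HeckeCharacter.ofDirichlet χ z : ℂˣ) : ℂ) = χ (d : ZMod N) := by
  have hu : ((Rat.rayClassHom N z)⁻¹ : (ZMod N)ˣ) = ZMod.unitOfCoprime (d : ZMod N).val
      (by
        have h := (ZMod.isUnit_iff_coprime (d : ZMod N).val N).1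
        rw [ZMod.natCast_zmod_val] at h
        exact h (IsUnit.of_mul_eq_one_right _ had)) := by
    refine Units.ext ?_
    have h1 : ((Rat.rayClassHom N z : (ZMod N)ˣ) : ZMod N) * (d : ZMod N) = 1 := by rw [hz]; exact had
    rw [ZMod.coe_unitOfCoprime, ZMod.natCast_zmod_val]
    exact Units.inv_eq_of_mul_eq_one_right h1
  rw [HeckeCharacter.ofDirichlet_apply, ← map_inv, hu, MulChar.coe_toUnitHom, ZMod.coe_unitOfCoprime,
    ZMod.natCast_zmod_val]

end LevelUnit

/-! ### The nebentypus of a `K₁(N)`-vector with central character `ψ_χ` -/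

section Nebentypus

variable {N : ℕ} [NeZero N]

omit [NeZero N] in
/-- Entries of `mapGL ℚ B` for `B ∈ SL₂(ℤ)`. [folklore] -/
theorem coe_mapGL_rat_apply (B : SL(2, ℤ)) (i j : Fin 2) :
    ((Matrix.SpecialLinearGroup.mapGL ℚ B : GL (Fin 2) ℚ) : Matrix (Fin 2) (Fin 2) ℚ) i j =
      ((B : Matrix (Fin 2) (Fin 2) ℤ) i j : ℚ) := rfl

omit [NeZero N] in
/-- The finite-adelic image of an integer is integral. [folklore] -/
theorem algebraMap_intCast_mem_integralFiniteAdeles (m : ℤ) :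
    algebraMap ℚ (FiniteAdeleRing (𝓞 ℚ) ℚ) (m : ℚ) ∈ integralFiniteAdeles ℚ := by
  rw [Rat.algebraMap_mem_integralFiniteAdeles_iff]
  intro v
  rw [← map_intCast (algebraMap (𝓞 ℚ) ℚ), valuation_of_algebraMap]
  exact intValuation_le_one v _

/-- The finite-adelic image of an integer divisible by `N` lies in `N ẑ`. [folklore] -/
theorem algebraMap_intCast_mem_levelIdeal {m : ℤ} (hm : (N : ℤ) ∣ m) :
    algebraMap ℚ (FiniteAdeleRing (𝓞 ℚ) ℚ) (m : ℚ) ∈ levelIdeal ℚ (Ideal.span {(N : 𝓞 ℚ)}) := by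
  obtain ⟨m, rfl⟩ := hm
  rw [Rat.algebraMap_mem_levelIdeal_iff (NeZero.ne N)]
  intro v
  rw [Int.cast_mul, Int.cast_natCast, Valuation.map_mul]
  have hz : v.valuation ℚ (m : ℚ) ≤ 1 := by
    rw [← map_intCast (algebraMap (𝓞 ℚ) ℚ), valuation_of_algebraMap]
    exact intValuation_le_one v _
  exact mul_le_of_le_one_right zero_le hz

/-- **`K₀(N) = Z(𝒪̂ˣ) K₁(N)` for `Γ₀(N)`**: for `B = (a b; c d) ∈ Γ₀(N)` and a finite idele `z_f`
which is `d` at the primes dividing `N` and `1` elsewhere, the finite-adelic matrix `z_f⁻¹ · B`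
lies in `K₁(N)` (`d z_f⁻¹ ≡ 1`, `c ≡ 0 (mod N ẑ)`). [cite: Gelbart1975, (3.2)–(3.5)] -/
theorem scalar_inv_mul_mapGL_mem_gammaOneFiniteLevel {B : SL(2, ℤ)} (hB : B ∈ CongruenceSubgroup.Gamma0 N)
    {zf : (FiniteAdeleRing (𝓞 ℚ) ℚ)ˣ}
    (hzf1 : ∀ v : HeightOneSpectrum (𝓞 ℚ), v.asIdeal ∣ Ideal.span {(N : 𝓞 ℚ)} →
      (zf : FiniteAdeleRing (𝓞 ℚ) ℚ) v = algebraMap ℚ (v.adicCompletion ℚ) (((B : Matrix (Fin 2) (Fin 2) ℤ) 1 1 : ℤ) : ℚ))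
    (hzf2 : ∀ v : HeightOneSpectrum (𝓞 ℚ), ¬ v.asIdeal ∣ Ideal.span {(N : 𝓞 ℚ)} → (zf : FiniteAdeleRing (𝓞 ℚ) ℚ) v = 1)
    (hzf3 : ∀ v : HeightOneSpectrum (𝓞 ℚ), Valued.v ((zf : FiniteAdeleRing (𝓞 ℚ) ℚ) v) = 1) :
    (Matrix.GeneralLinearGroup.scalar (Fin 2) zf)⁻¹ *
        Matrix.GeneralLinearGroup.map (algebraMap ℚ (FiniteAdeleRing (𝓞 ℚ) ℚ)) (Matrix.SpecialLinearGroup.mapGL ℚ B) ∈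
      gammaOneFiniteLevel ℚ (Ideal.span {(N : 𝓞 ℚ)}) := by
  set k : GL (Fin 2) (FiniteAdeleRing (𝓞 ℚ) ℚ) :=
    Matrix.GeneralLinearGroup.map (algebraMap ℚ (FiniteAdeleRing (𝓞 ℚ) ℚ)) (Matrix.SpecialLinearGroup.mapGL ℚ B) with hk
  -- integrality of the two scalars
  have hz_int : ((zf : (FiniteAdeleRing (𝓞 ℚ) ℚ)ˣ) : FiniteAdeleRing (𝓞 ℚ) ℚ) ∈ integralFiniteAdeles ℚ := fun v =>
    (mem_adicCompletionIntegers (R := 𝓞 ℚ) ℚ v).2 (hzf3 v).le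
  have hzz : ∀ v, ((zf⁻¹ : (FiniteAdeleRing (𝓞 ℚ) ℚ)ˣ) : FiniteAdeleRing (𝓞 ℚ) ℚ) v *
      ((zf : (FiniteAdeleRing (𝓞 ℚ) ℚ)ˣ) : FiniteAdeleRing (𝓞 ℚ) ℚ) v = 1 := fun v => by
    rw [← FiniteAdeleRing.mul_apply', Units.inv_mul]; rfl
  have hzinv_val : ∀ v, Valued.v (((zf⁻¹ : (FiniteAdeleRing (𝓞 ℚ) ℚ)ˣ) : FiniteAdeleRing (𝓞 ℚ) ℚ) v) = 1 := fun v => by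
    have h := congrArg Valued.v (hzz v)
    rw [Valuation.map_mul, Valuation.map_one, hzf3 v, mul_one] at h
    exact h
  have hzinv_int : ((zf⁻¹ : (FiniteAdeleRing (𝓞 ℚ) ℚ)ˣ) : FiniteAdeleRing (𝓞 ℚ) ℚ) ∈ integralFiniteAdeles ℚ := fun v =>
    (mem_adicCompletionIntegers (R := 𝓞 ℚ) ℚ v).2 (hzinv_val v).le
  -- entries of `k` and `k⁻¹`
  have hk_apply : ∀ i j, (k : Matrix (Fin 2) (Fin 2) (FiniteAdeleRing (𝓞 ℚ) ℚ)) i j =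
      algebraMap ℚ (FiniteAdeleRing (𝓞 ℚ) ℚ) (((B : Matrix (Fin 2) (Fin 2) ℤ) i j : ℚ)) := fun i j => by
    rw [hk, Matrix.GeneralLinearGroup.map_apply, coe_mapGL_rat_apply]
  have hkinv_apply : ∀ i j, ((k⁻¹ : GL (Fin 2) (FiniteAdeleRing (𝓞 ℚ) ℚ)) : Matrix (Fin 2) (Fin 2) (FiniteAdeleRing (𝓞 ℚ) ℚ)) i j =
      algebraMap ℚ (FiniteAdeleRing (𝓞 ℚ) ℚ) ((((B⁻¹ : SL(2, ℤ)) : Matrix (Fin 2) (Fin 2) ℤ) i j : ℚ)) := fun i j => by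
    rw [hk, ← map_inv, ← map_inv, Matrix.GeneralLinearGroup.map_apply, coe_mapGL_rat_apply]
  -- entries of `u₁ = z⁻¹ k` and `u₁⁻¹ = k⁻¹ z`
  have hu_apply : ∀ i j, (((Matrix.GeneralLinearGroup.scalar (Fin 2) zf)⁻¹ * k : GL (Fin 2) (FiniteAdeleRing (𝓞 ℚ) ℚ)) :
      Matrix (Fin 2) (Fin 2) (FiniteAdeleRing (𝓞 ℚ) ℚ)) i j =
      ((zf⁻¹ : (FiniteAdeleRing (𝓞 ℚ) ℚ)ˣ) : FiniteAdeleRing (𝓞 ℚ) ℚ) *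
        algebraMap ℚ (FiniteAdeleRing (𝓞 ℚ) ℚ) (((B : Matrix (Fin 2) (Fin 2) ℤ) i j : ℚ)) := fun i j => by
    rw [← map_inv, Units.val_mul, Matrix.GeneralLinearGroup.coe_scalar, Matrix.scalar_apply, Matrix.diagonal_mul,
      hk_apply]
  have huinv_apply : ∀ i j, ((((Matrix.GeneralLinearGroup.scalar (Fin 2) zf)⁻¹ * k)⁻¹ : GL (Fin 2) (FiniteAdeleRing (𝓞 ℚ) ℚ)) :
      Matrix (Fin 2) (Fin 2) (FiniteAdeleRing (𝓞 ℚ) ℚ)) i j =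
      algebraMap ℚ (FiniteAdeleRing (𝓞 ℚ) ℚ) ((((B⁻¹ : SL(2, ℤ)) : Matrix (Fin 2) (Fin 2) ℤ) i j : ℚ)) *
        ((zf : (FiniteAdeleRing (𝓞 ℚ) ℚ)ˣ) : FiniteAdeleRing (𝓞 ℚ) ℚ) := fun i j => by
    rw [_root_.mul_inv_rev, inv_inv, Units.val_mul, Matrix.GeneralLinearGroup.coe_scalar, Matrix.scalar_apply,
      Matrix.mul_diagonal, hkinv_apply]
  -- the congruences of `B`
  have h10 : (N : ℤ) ∣ (B : Matrix (Fin 2) (Fin 2) ℤ) 1 0 := by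
    rw [CongruenceSubgroup.Gamma0_mem] at hB
    exact (ZMod.intCast_zmod_eq_zero_iff_dvd _ N).1 hB
  have hinv10 : ((B⁻¹ : SL(2, ℤ)) : Matrix (Fin 2) (Fin 2) ℤ) 1 0 = -(B : Matrix (Fin 2) (Fin 2) ℤ) 1 0 := by
    rw [Matrix.SpecialLinearGroup.coe_inv, Matrix.adjugate_fin_two]
    simp
  -- the local congruence `z_v ≡ d (mod N ℤ_v)`
  have hcong : ∀ v : HeightOneSpectrum (𝓞 ℚ),
      Valued.v (algebraMap ℚ (v.adicCompletion ℚ) (((B : Matrix (Fin 2) (Fin 2) ℤ) 1 1 : ℤ) : ℚ) -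
        ((zf : (FiniteAdeleRing (𝓞 ℚ) ℚ)ˣ) : FiniteAdeleRing (𝓞 ℚ) ℚ) v) ≤ idealRadius ℚ v (Ideal.span {(N : 𝓞 ℚ)}) := by
    intro v
    by_cases hv : v.asIdeal ∣ Ideal.span {(N : 𝓞 ℚ)}
    · rw [hzf1 v hv, sub_self, map_zero]; exact zero_le
    · rw [hzf2 v hv, idealRadius_eq_one_of_not_dvd (Rat.span_natCast_ne_zero N) hv,
        ← map_one (algebraMap ℚ (v.adicCompletion ℚ)), ← map_sub,
        Literature.NumberTheory.GaloisRepresentations.valued_algebraMap_adicCompletion,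
        show (((B : Matrix (Fin 2) (Fin 2) ℤ) 1 1 : ℤ) : ℚ) - 1 = (((B : Matrix (Fin 2) (Fin 2) ℤ) 1 1 - 1 : ℤ) : ℚ) by
          push_cast; ring,
        ← map_intCast (algebraMap (𝓞 ℚ) ℚ), valuation_of_algebraMap]
      exact intValuation_le_one v _
  rw [mem_gammaOneFiniteLevel_iff, mem_gammaZeroFiniteLevel_iff, mem_eichlerOrder_iff, mem_eichlerOrder_iff]
  refine ⟨⟨⟨fun i j => ?_, ?_⟩, fun i j => ?_, ?_⟩, ?_⟩
  · rw [hu_apply]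
    exact mul_mem hzinv_int (algebraMap_intCast_mem_integralFiniteAdeles _)
  · rw [hu_apply]
    exact mul_mem_levelIdeal hzinv_int (algebraMap_intCast_mem_levelIdeal h10)
  · rw [huinv_apply]
    exact mul_mem (algebraMap_intCast_mem_integralFiniteAdeles _) hz_int
  · rw [huinv_apply, hinv10, Int.cast_neg, map_neg, neg_mul]
    exact neg_mem (mul_mem_levelIdeal' (algebraMap_intCast_mem_levelIdeal h10) hz_int)
  · rw [hu_apply, mem_levelIdeal_iff]
    intro v
    have e : (((zf⁻¹ : (FiniteAdeleRing (𝓞 ℚ) ℚ)ˣ) : FiniteAdeleRing (𝓞 ℚ) ℚ) *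
          algebraMap ℚ (FiniteAdeleRing (𝓞 ℚ) ℚ) (((B : Matrix (Fin 2) (Fin 2) ℤ) 1 1 : ℚ)) - 1) v =
        ((zf⁻¹ : (FiniteAdeleRing (𝓞 ℚ) ℚ)ˣ) : FiniteAdeleRing (𝓞 ℚ) ℚ) v *
          (algebraMap ℚ (v.adicCompletion ℚ) (((B : Matrix (Fin 2) (Fin 2) ℤ) 1 1 : ℚ)) -
            ((zf : (FiniteAdeleRing (𝓞 ℚ) ℚ)ˣ) : FiniteAdeleRing (𝓞 ℚ) ℚ) v) := by
      rw [mul_sub, hzz v]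
      rfl
    rw [e, Valuation.map_mul, hzinv_val v, one_mul]
    exact hcong v

/-- **The nebentypus of a `K₁(N)`-vector** (Gelbart 1975, (3.5) and Prop. 3.1 (ii), (iv) for
`K₀(N)`): let `φ` on `GL₂(𝔸_ℚ)` be left `GL₂(ℚ)`-invariant, right invariant under `{1} × K₁(N)`
and transform under the scalar ideles by `ψ_χ = HeckeCharacter.ofDirichlet χ`
(`φ(g z) = ψ_χ(z) φ(g)`).  Then for `γ = (a b; c d) ∈ Γ₀(N)` and `g ∈ GL₂(ℝ)`,
`φ((γ_∞ g, 1)) = χ(d) φ((g, 1))`: indeed `(γ_∞, 1) = γ_ℚ (1, γ_f⁻¹)`, `γ_f⁻¹ = z(a) k₁` with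
`k₁ ∈ K₁(N)` and `ψ_χ(z(a)) = χ(a)⁻¹ = χ(d)`. [cite: Gelbart1975, (3.5), Prop. 3.1] -/
theorem apply_ofRealGL_gamma0_mul (χ : DirichletCharacter ℂ N) {φ : GL (Fin 2) (AdeleRing (𝓞 ℚ) ℚ) → ℂ}
    (hleft : ∀ (γ : GL (Fin 2) ℚ) (g : GL (Fin 2) (AdeleRing (𝓞 ℚ) ℚ)), φ (GLn.ofGlobal 2 ℚ γ * g) = φ g)
    (hright : ∀ h ∈ gammaOneFiniteLevel ℚ (Ideal.span {(N : 𝓞 ℚ)}),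
      ∀ g : GL (Fin 2) (AdeleRing (𝓞 ℚ) ℚ), φ (g * GLn.ofFinite 2 ℚ h) = φ g)
    (hcen : ∀ (z : ideleGroup ℚ) (g : GL (Fin 2) (AdeleRing (𝓞 ℚ) ℚ)),
      φ (g * Matrix.GeneralLinearGroup.scalar (Fin 2) z) = ((HeckeCharacter.ofDirichlet χ z : ℂˣ) : ℂ) * φ g)
    {A : SL(2, ℤ)} (hA : A ∈ CongruenceSubgroup.Gamma0 N) (g : GL (Fin 2) ℝ) :
    φ (Rat.ofRealGL 2 (Matrix.SpecialLinearGroup.mapGL ℝ A * g)) =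
      χ (((A : Matrix (Fin 2) (Fin 2) ℤ) 1 1 : ℤ) : ZMod N) * φ (Rat.ofRealGL 2 g) := by
  -- the entries of `A` and `A⁻¹`
  have hdet : (A : Matrix (Fin 2) (Fin 2) ℤ) 0 0 * (A : Matrix (Fin 2) (Fin 2) ℤ) 1 1 -
      (A : Matrix (Fin 2) (Fin 2) ℤ) 0 1 * (A : Matrix (Fin 2) (Fin 2) ℤ) 1 0 = 1 := by
    rw [← Matrix.det_fin_two, A.det_coe]
  have h10 : (N : ℤ) ∣ (A : Matrix (Fin 2) (Fin 2) ℤ) 1 0 := by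
    rw [CongruenceSubgroup.Gamma0_mem] at hA
    exact (ZMod.intCast_zmod_eq_zero_iff_dvd _ N).1 hA
  obtain ⟨m, hm⟩ := h10
  have hAinv : (A⁻¹ : SL(2, ℤ)) ∈ CongruenceSubgroup.Gamma0 N := inv_mem hA
  have hinv11 : ((A⁻¹ : SL(2, ℤ)) : Matrix (Fin 2) (Fin 2) ℤ) 1 1 = (A : Matrix (Fin 2) (Fin 2) ℤ) 0 0 := by
    rw [Matrix.SpecialLinearGroup.coe_inv, Matrix.adjugate_fin_two]
    simp
  have hcop : IsCoprime (((A⁻¹ : SL(2, ℤ)) : Matrix (Fin 2) (Fin 2) ℤ) 1 1) N := by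
    rw [hinv11]
    refine ⟨(A : Matrix (Fin 2) (Fin 2) ℤ) 1 1, -((A : Matrix (Fin 2) (Fin 2) ℤ) 0 1 * m), ?_⟩
    linear_combination hdet + (A : Matrix (Fin 2) (Fin 2) ℤ) 0 1 * hm
  have had : ((((A⁻¹ : SL(2, ℤ)) : Matrix (Fin 2) (Fin 2) ℤ) 1 1 : ℤ) : ZMod N) *
      (((A : Matrix (Fin 2) (Fin 2) ℤ) 1 1 : ℤ) : ZMod N) = 1 := by
    rw [hinv11]
    have h := congrArg (fun z : ℤ => (z : ZMod N)) hdet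
    simp only [Int.cast_sub, Int.cast_mul, Int.cast_one, hm, Int.cast_natCast, ZMod.natCast_self, zero_mul,
      mul_zero, sub_zero] at h
    exact h
  -- the level unit idele of `a`
  obtain ⟨z, zf, hzval, hzf1, hzf2, hzf3, hray⟩ := exists_levelUnitIdele N hcop
  have hscalar : GLn.ofFinite 2 ℚ (Matrix.GeneralLinearGroup.scalar (Fin 2) zf) = Matrix.GeneralLinearGroup.scalar (Fin 2) z := by
    refine Matrix.GeneralLinearGroup.ext fun i j => ?_
    rw [GLn.coe_ofFinite_apply, Matrix.GeneralLinearGroup.coe_scalar, Matrix.GeneralLinearGroup.coe_scalar,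
      Matrix.scalar_apply, Matrix.scalar_apply, Matrix.diagonal_apply, Matrix.diagonal_apply, Matrix.one_apply, hzval]
    by_cases hij : i = j
    · rw [if_pos hij, if_pos hij, if_pos hij]
    · rw [if_neg hij, if_neg hij, if_neg hij]; rfl
  -- the decomposition `(γ_∞, 1) = γ_ℚ · (1, z) · (1, u₁)`
  set k : GL (Fin 2) (FiniteAdeleRing (𝓞 ℚ) ℚ) := GLn.sndHom 2 ℚ (GLn.ofGlobal 2 ℚ (Matrix.SpecialLinearGroup.mapGL ℚ A))
    with hk
  have hkinv : k⁻¹ = Matrix.GeneralLinearGroup.map (algebraMap ℚ (FiniteAdeleRing (𝓞 ℚ) ℚ))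
      (Matrix.SpecialLinearGroup.mapGL ℚ A⁻¹) := by
    rw [hk, Rat.sndHom_ofGlobal, ← map_inv, ← map_inv]
  have hu₁ : (Matrix.GeneralLinearGroup.scalar (Fin 2) zf)⁻¹ * k⁻¹ ∈ gammaOneFiniteLevel ℚ (Ideal.span {(N : 𝓞 ℚ)}) := by
    rw [hkinv]
    exact scalar_inv_mul_mapGL_mem_gammaOneFiniteLevel hAinv hzf1 hzf2 hzf3
  have e1 : Rat.ofRealGL 2 (Matrix.SpecialLinearGroup.mapGL ℝ A) =
      GLn.ofGlobal 2 ℚ (Matrix.SpecialLinearGroup.mapGL ℚ A) * GLn.ofFinite 2 ℚ k⁻¹ := by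
    rw [map_inv, Rat.ofGlobal_mapGL_eq A, ← hk, mul_inv_cancel_right]
  have e2 : GLn.ofFinite 2 ℚ k⁻¹ = Matrix.GeneralLinearGroup.scalar (Fin 2) z *
      GLn.ofFinite 2 ℚ ((Matrix.GeneralLinearGroup.scalar (Fin 2) zf)⁻¹ * k⁻¹) := by
    rw [map_mul, ← mul_assoc, ← hscalar, ← map_mul, mul_inv_cancel, map_one, one_mul]
  rw [map_mul, e1, mul_assoc, ← Rat.ofRealGL_mul_ofFinite_comm, hleft, e2, ← mul_assoc, hright _ hu₁, hcen,
    ofDirichlet_eq_of_rayClassHom χ hray had]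

/-- **Registered sub-goal `stub_descent_nebentypus` of `stub_descent`** (closed form of
`apply_ofRealGL_gamma0_mul`): the nebentypus `χ(d)` of a left `GL₂(ℚ)`-invariant, right
`K₁(N)`-invariant function with central character `ψ_χ`, along `Γ₀(N)`.
[cite: Gelbart1975, (3.5), Prop. 3.1] -/
theorem stub_descent_nebentypus : ∀ (N : ℕ) [NeZero N] (χ : DirichletCharacter ℂ N) (φ : GL (Fin 2) (AdeleRing (𝓞 ℚ) ℚ) → ℂ), (∀ (γ : GL (Fin 2) ℚ) (g : GL (Fin 2) (AdeleRing (𝓞 ℚ) ℚ)), φ (GLn.ofGlobal 2 ℚ γ * g) = φ g) → (∀ h ∈ gammaOneFiniteLevel ℚ (Ideal.span {(N : 𝓞 ℚ)}), ∀ g : GL (Fin 2) (AdeleRing (𝓞 ℚ) ℚ), φ (g * GLn.ofFinite 2 ℚ h) = φ g) → (∀ (z : ideleGroup ℚ) (g : GL (Fin 2) (AdeleRing (𝓞 ℚ) ℚ)), φ (g * Matrix.GeneralLinearGroup.scalar (Fin 2) z) = ((HeckeCharacter.ofDirichlet χ z : ℂˣ) : ℂ) * φ g) → ∀ (A : Matrix.SpecialLinearGroup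 (Fin 2) ℤ), A ∈ CongruenceSubgroup.Gamma0 N → ∀ g : GL (Fin 2) ℝ, φ (Rat.ofRealGL 2 (Matrix.SpecialLinearGroup.mapGL ℝ A * g)) = χ (((A : Matrix (Fin 2) (Fin 2) ℤ) 1 1 : ℤ) : ZMod N) * φ (Rat.ofRealGL 2 g) :=
  fun _ _ χ _ hleft hright hcen _ hA g => apply_ofRealGL_gamma0_mul χ hleft hright hcen hA g

end Nebentypus

end Summit.Langlands.Langlands.Theorems.CorrespondentFingerprint
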